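/- Width seat `ym-line-cbag-p1-w3` (prover-ym-line-cbag-p1-w3-g0-0), route `ColdBoxAllGroups`, crux `BoxFloorAllGroups`
(stmt-QuantumFields-22254), line `birth`, skeleton v4 / lead's PLAN v5: brick B4 «RepresentationG» of stub S2. -/
import Summits.QuantumFields.YangMills.Theorems.ColdBoxAllGroupsBoxFloorAllGroupsRepresentationGaussG
import Summits.QuantumFields.YangMills.Theorems.ColdBoxAllGroupsBoxFloorAllGroupsLinkSmallG
import Summits.QuantumFields.YangMills.Theorems.WeakCouplingRatesColdBoxRepresentation
import Summits.QuantumFields.YangMills.Theorems.EquipartitionCriticalityFreeEnergyLogCoefficientStubExpChartPackage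

/-!
# Crux `BoxFloorAllGroups`, brick B4 «RepresentationG»: the small-field conditioned cold-wall box state of EVERY compact group
# presented in `U(N)` is a bounded tilt of the conditioned `D`-colour Dirichlet Gaussian `boxDirichlet^{⊗D}`, read in the exponential chart

`G`-generic port of `WeakCouplingRatesColdBoxRepresentation.integral_cond_boxState_eq_integral_tilted` (the `SU(2)` brick R4 of the
proved crux `ColdBoxTwoPointFloorW`, gnomonic chart, three colours) in the lead's vocabulary `ColdBoxAllGroupsOneScaleDefs`
(`coldGoodSetG`, `chartCfgE`, `TSpaceD`, `gaussD`, `qObsD`, `unscaleTE`, `scaleEquivE`, `cfgTE`, `goodTE`, `tiltWE`), with the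
exponential chart `ψ = expChart ρ` of the faithful unitary `ρ : G →* U(N)` and `D = dimE ρ` colours.  Two features differ from `SU(2)`:
(i) the exponential chart is LOCAL, so the Gaussian-side event is `goodTE ∩ windowTE r` where
`windowTE r = {t | ∀ e, ‖unscaleTE t e‖ ≤ r}` is the image of the chart ball `B = closedBall 0 r` (on the small-field event
every gauge-fixed link IS in `ψ(B)` — brick B3 «LinkSmallG» + local surjectivity, entered as the hypothesis `hball`); (ii) the Haar measure
in the chart is `c · g · Lebesgue` on `B` with a DENSITY `g > 0` which is a PARAMETER here, entered as the hypothesis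
`(chartMeasureE ρ (1/4)).restrict B = (c • volume.restrict B).withDensity (ofReal ∘ g)` (produced by the lead's brick B5 «ChartDensityG»
from the landed soft sandwich; `κE(r)^{−D} ≤ g ≤ 1`).

* (part 1, `…RepresentationGaussG`: the Gaussian side with `D` colours — constant-Jacobian change of variables, `Z^D`, and the density
  identity `e^{−βS_Λ(cfgTE t)}·Π_e g(a_e) = Π_i gaussWeight(t i)·e^{tiltWE t}`.)
* §3 (box side) `integral_cond_boxState_eq_ratio_G` (conditional expectations of gauge-invariant observables are ratios of free-link
  integrals in the temporal-forest gauge, `integral_boxState_eq_coldFree`), `mem_image_expChart_of_mem_coldGoodSetG` (on the good event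
  every free link is in `ψ(B)`), `freeIntegral_indicator_eq_lintegral_chart_G` (product chart `lintegral_pi_image_expChart` + the density
  hypothesis: `N(𝟙_G Ψ) = c^n·∫⁻_{B^n} 𝟙_G Ψ e^{−βS}(chartCfgE w)·Π_e g(w_e) dw`), `lintegral_chart_eq_const_mul_lintegral_gaussD`.
* §4 **`integral_cond_boxState_eq_integral_tilted_G`** — THE REPRESENTATION: for measurable gauge-invariant `X ≥ 0`,
  `∫ X d(boxState ρ β H [|coldGoodSetG]) = ∫ X(cfgTE t) d(((gaussD H D)[|S]).tilted (𝟙_S·tiltWE ρ H g β))(t)`, `S = goodTE ∩ windowTE r`.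
All constants (`c^n`, the Jacobian `a`, `Z^D`) cancel.  No sorry; no new definition (the window is written as a set-builder); standard
axioms.  NOT a claim about the Yang–Mills mass gap (rung-level support, RECORD label).
-/

set_option autoImplicit false
set_option synthInstance.maxSize 4096

noncomputable section

open MeasureTheory ProbabilityTheory Finset Metric
open scoped ENNReal Matrix.Norms.Frobenius
open Literature.Probability.LatticeModels (Site)
open Literature.MathematicalPhysics.QuantumLattice
open Literature.MathematicalPhysics.QuantumFieldTheory
open Literature.MathematicalPhysics.QuantumFieldTheory.LatticeMaxwell
open Literature.MathematicalPhysics.QuantumFieldTheory.AxialGauge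
open Literature.MathematicalPhysics.QuantumFieldTheory.GaussianToolkit

namespace Summit.QuantumFields.YangMills.Theorems.ColdBoxAllGroups

open Summit.QuantumFields.YangMills.Theorems.WeakCouplingRates
open Summit.QuantumFields.YangMills.Theorems.FreeEnergyLogCoefficient

variable {H : ℕ}

/-! ## §3 The box side: free-link integrals, the product chart and the density -/

section Box

variable {N : ℕ} {G : Type} [Group G] [TopologicalSpace G] [IsTopologicalGroup G] [CompactSpace G]
  [MeasurableSpace G] [BorelSpace G] [SecondCountableTopology G]
variable (ρ : G →* Matrix (Fin N) (Fin N) ℂ)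

omit [TopologicalSpace G] [IsTopologicalGroup G] [CompactSpace G] [MeasurableSpace G] [BorelSpace G] [SecondCountableTopology G] in
/-- The small-field event is gauge invariant. -/
theorem gaugeTransformZd_mem_coldGoodSetG_iff (β ε : ℝ) (g : Site 4 → G) (U : LGConfig 4 G) :
    gaugeTransformZd g U ∈ coldGoodSetG ρ H β ε ↔ U ∈ coldGoodSetG ρ H β ε := by
  simp only [coldGoodSetG, Set.mem_compl_iff, Set.mem_setOf_eq, isZdGaugeInvariant_plaquetteObs _ _ _ _ g U]

omit [TopologicalSpace G] [IsTopologicalGroup G] [CompactSpace G] [MeasurableSpace G] [BorelSpace G] [SecondCountableTopology G] in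
/-- The indicator of the small-field event times a gauge-invariant observable is gauge invariant. -/
theorem isZdGaugeInvariant_indicator_coldGoodSetG (β ε : ℝ) {X : LGConfig 4 G → ℝ} (hX : IsZdGaugeInvariant X) :
    IsZdGaugeInvariant ((coldGoodSetG ρ H β ε).indicator X) := by
  intro g U
  by_cases hU : U ∈ coldGoodSetG ρ H β ε
  · rw [Set.indicator_of_mem hU, Set.indicator_of_mem ((gaugeTransformZd_mem_coldGoodSetG_iff ρ β ε g U).2 hU), hX]
  · rw [Set.indicator_of_notMem hU,
      Set.indicator_of_notMem (fun h => hU ((gaugeTransformZd_mem_coldGoodSetG_iff ρ β ε g U).1 h))]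

/-- The free-link integral `N(𝟙_G X) = ∫ (𝟙_G X)(U_v) e^{−βS_Λ(U_v)} dσ^{free}(v)` of the temporal-forest gauge expresses `∫ 𝟙_G X d(boxState)`. -/
theorem integral_boxState_indicator_eq_G (hρc : Continuous ρ) (β ε : ℝ) (H : ℕ) {X : LGConfig 4 G → ℝ} (hXm : Measurable X)
    (hX : IsZdGaugeInvariant X) :
    ∫ U, (coldGoodSetG ρ H β ε).indicator X U ∂(boxState ρ β H) =
      (∫ v, (coldGoodSetG ρ H β ε).indicator X (coldExt (coldExt₁ v)) *
          Real.exp (-β * wilsonBoundaryAction ρ (boxEdges 4 (2 * H + 1)) (coldExt (coldExt₁ v)))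
        ∂(Measure.pi fun _ : ColdFreeIdx H => haarProbability G)) /
      ∫ v, Real.exp (-β * wilsonBoundaryAction ρ (boxEdges 4 (2 * H + 1)) (coldExt (coldExt₁ v)))
        ∂(Measure.pi fun _ : ColdFreeIdx H => haarProbability G) :=
  integral_boxState_eq_coldFree ρ hρc β H (hXm.indicator (measurableSet_coldGoodSetG ρ hρc β ε))
    (isZdGaugeInvariant_indicator_coldGoodSetG ρ β ε hX)

/-- **Step 1.**  `E_{boxState[|G]}[X] = N(𝟙_G X) / N(𝟙_G)` for measurable gauge-invariant `X` (`G = coldGoodSetG ρ H β ε` charged). -/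
theorem integral_cond_boxState_eq_ratio_G (hρc : Continuous ρ) (β ε : ℝ) (H : ℕ) (hG0 : boxState ρ β H (coldGoodSetG ρ H β ε) ≠ 0)
    {X : LGConfig 4 G → ℝ} (hXm : Measurable X) (hX : IsZdGaugeInvariant X) :
    ∫ U, X U ∂((boxState ρ β H)[|coldGoodSetG ρ H β ε]) =
      (∫ v, (coldGoodSetG ρ H β ε).indicator X (coldExt (coldExt₁ v)) *
          Real.exp (-β * wilsonBoundaryAction ρ (boxEdges 4 (2 * H + 1)) (coldExt (coldExt₁ v)))
        ∂(Measure.pi fun _ : ColdFreeIdx H => haarProbability G)) /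
      ∫ v, (coldGoodSetG ρ H β ε).indicator (fun _ => (1 : ℝ)) (coldExt (coldExt₁ v)) *
          Real.exp (-β * wilsonBoundaryAction ρ (boxEdges 4 (2 * H + 1)) (coldExt (coldExt₁ v)))
        ∂(Measure.pi fun _ : ColdFreeIdx H => haarProbability G) := by
  haveI : IsProbabilityMeasure (boxState ρ β H) := isProbabilityMeasure_ymSpecification _ hρc β _ _
  set μ := boxState ρ β H with hμ
  set Gd := coldGoodSetG ρ H β ε with hG
  have hGm : MeasurableSet Gd := measurableSet_coldGoodSetG ρ hρc β ε
  have hnum : ∫ U in Gd, X U ∂μ = ∫ U, Gd.indicator X U ∂μ := (integral_indicator hGm).symm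
  have hmass : μ.real Gd = ∫ U, Gd.indicator (fun _ => (1 : ℝ)) U ∂μ := by
    rw [integral_indicator hGm, setIntegral_const, smul_eq_mul, mul_one]
  rw [integral_cond_eq, hnum, hmass, hG, integral_boxState_indicator_eq_G ρ hρc β ε H hXm hX,
    integral_boxState_indicator_eq_G ρ hρc β ε H measurable_const (fun _ _ => rfl)]
  set A := ∫ v, (coldGoodSetG ρ H β ε).indicator X (coldExt (coldExt₁ v)) *
      Real.exp (-β * wilsonBoundaryAction ρ (boxEdges 4 (2 * H + 1)) (coldExt (coldExt₁ v)))
    ∂(Measure.pi fun _ : ColdFreeIdx H => haarProbability G) with hA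
  set B := ∫ v, (coldGoodSetG ρ H β ε).indicator (fun _ => (1 : ℝ)) (coldExt (coldExt₁ v)) *
      Real.exp (-β * wilsonBoundaryAction ρ (boxEdges 4 (2 * H + 1)) (coldExt (coldExt₁ v)))
    ∂(Measure.pi fun _ : ColdFreeIdx H => haarProbability G) with hB
  set Z := ∫ v, Real.exp (-β * wilsonBoundaryAction ρ (boxEdges 4 (2 * H + 1)) (coldExt (coldExt₁ v)))
    ∂(Measure.pi fun _ : ColdFreeIdx H => haarProbability G) with hZ
  have hBZ : B / Z = μ.real Gd := by
    rw [hmass, hG, integral_boxState_indicator_eq_G ρ hρc β ε H measurable_const (fun _ _ => rfl)]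
  have hreal : μ.real Gd ≠ 0 := by
    rw [measureReal_def]; exact ENNReal.toReal_ne_zero.2 ⟨hG0, measure_ne_top _ _⟩
  have hB0 : B ≠ 0 := fun h => hreal (by rw [← hBZ, h, zero_div])
  have hZ0 : Z ≠ 0 := fun h => hreal (by rw [← hBZ, h, div_zero])
  field_simp

omit [TopologicalSpace G] [IsTopologicalGroup G] [CompactSpace G] [MeasurableSpace G] [BorelSpace G] [SecondCountableTopology G] in
/-- **On the small-field event every free link of the gauge-fixed configuration lies in the chart image `ψ(B)`** (brick B3 «LinkSmallG»:
`‖ρ(V_e) − 1‖_F ≤ (12H²+2H+1)·√2·√(β^{2ε−1})`, and the local-surjectivity hypothesis `hball`). -/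
theorem mem_image_expChart_of_mem_coldGoodSetG (hρu : ∀ g, ρ g ∈ Matrix.unitaryGroup (Fin N) ℂ) {β ε : ℝ} (hβ : 0 < β) (hH : 1 ≤ H)
    {B : Set (EuclideanSpace ℝ (Fin (dimE ρ)))}
    (hball : ∀ u : G, ‖ρ u - 1‖ ≤ (12 * (H : ℝ) ^ 2 + 2 * H + 1) * (Real.sqrt 2 * Real.sqrt (β ^ (2 * ε - 1))) →
      u ∈ expChart ρ '' B)
    (v : ColdFreeCfg (G := G) H) (hv : coldExt (coldExt₁ v) ∈ coldGoodSetG ρ H β ε) (e : ColdFreeIdx H) :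
    v e ∈ expChart ρ '' B := by
  set V := coldExt (coldExt₁ v) with hV
  have hδ2 : Real.sqrt (β ^ (2 * ε - 1)) ^ 2 = β ^ (2 * ε - 1) := Real.sq_sqrt (Real.rpow_nonneg hβ.le _)
  have hcost : ∀ p ∈ plaquettesTouching (boxEdges 4 (2 * H + 1)),
      plaqCostAt ρ p.1 p.2.1.1 p.2.1.2 V ≤ Real.sqrt (β ^ (2 * ε - 1)) ^ 2 := by
    intro p hp
    rw [hδ2]
    exact ((mem_coldGoodSetG_iff ρ β ε V).1 hv p hp).le
  have hout : ∀ e, e ∉ boxEdges 4 (2 * H + 1) → V e = 1 := fun e he => coldExt_apply_not_mem _ he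
  have hforest : ∀ x : Site 4, (∀ k : Fin 4, 1 ≤ x k ∧ x k + 1 ≤ 2 * (H : ℤ)) → V (x, 0) = 1 := by
    intro x hx
    have hmem : (x, (0 : Fin 4)) ∈ boxEdges 4 (2 * H + 1) := by
      rw [mem_boxEdges_iff]
      refine ⟨fun k => ⟨by linarith [(hx k).1], ?_⟩, ?_⟩
      · have := (hx k).2; push_cast; omega
      · have := (hx 0).2; push_cast; omega
    rw [hV, coldExt_apply_mem _ ⟨_, hmem⟩, coldExt₁, dif_pos ⟨rfl, hx⟩]
  have hlink := frobDist_link_le_of_plaqCost_le ρ hρu hH V hout hforest (Real.sqrt_nonneg _) hcost e.1.1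
  have hVe : V e.1.1 = v e := by
    rw [hV, coldExt_apply_mem _ e.1, coldExt₁, dif_neg e.2]
  rw [hVe] at hlink
  exact hball _ hlink

/-- **Step 2.**  For measurable `Ψ ≥ 0`, under the link window `hball` for the chart ball `B = closedBall 0 r`, `r ≤ 1/4`, and a chart
density `g` with `ν|_B = (c·vol|_B)·g`:
`N(𝟙_G Ψ) = (c^n · ∫⁻_{B^n} 𝟙_G(chartCfgE w) Ψ(chartCfgE w) e^{−βS(chartCfgE w)} Π_e g(w_e) dw).toReal`. -/
theorem freeIntegral_indicator_eq_lintegral_chart_G (hρc : Continuous ρ) (hinj : Function.Injective ρ)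
    (hρu : ∀ g, ρ g ∈ Matrix.unitaryGroup (Fin N) ℂ) {β ε r : ℝ} (hβ : 0 < β) (hH : 1 ≤ H) (hr : r ≤ 1 / 4)
    (hball : ∀ u : G, ‖ρ u - 1‖ ≤ (12 * (H : ℝ) ^ 2 + 2 * H + 1) * (Real.sqrt 2 * Real.sqrt (β ^ (2 * ε - 1))) →
      u ∈ expChart ρ '' closedBall (0 : EuclideanSpace ℝ (Fin (dimE ρ))) r)
    {g : EuclideanSpace ℝ (Fin (dimE ρ)) → ℝ} (hgm : Measurable g) {c : ℝ≥0∞} (hctop : c ≠ ∞)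
    (hdens : (chartMeasureE ρ (1 / 4)).restrict (closedBall 0 r) =
      (c • (volume : Measure (EuclideanSpace ℝ (Fin (dimE ρ)))).restrict (closedBall 0 r)).withDensity
        (fun a => ENNReal.ofReal (g a)))
    {Ψ : LGConfig 4 G → ℝ} (hΨm : Measurable Ψ) (hΨ0 : ∀ U, 0 ≤ Ψ U) :
    ∫ v, (coldGoodSetG ρ H β ε).indicator Ψ (coldExt (coldExt₁ v)) *
          Real.exp (-β * wilsonBoundaryAction ρ (boxEdges 4 (2 * H + 1)) (coldExt (coldExt₁ v)))
        ∂(Measure.pi fun _ : ColdFreeIdx H => haarProbability G) =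
      (c ^ Fintype.card (ColdFreeIdx H) *
        ∫⁻ w in Set.pi Set.univ (fun _ => closedBall (0 : EuclideanSpace ℝ (Fin (dimE ρ))) r),
          ENNReal.ofReal ((coldGoodSetG ρ H β ε).indicator Ψ (chartCfgE ρ w) *
            Real.exp (-β * wilsonBoundaryAction ρ (boxEdges 4 (2 * H + 1)) (chartCfgE ρ w))) *
          ∏ e, ENNReal.ofReal (g (w e)) ∂(volume : Measure (ColdFreeIdx H → EuclideanSpace ℝ (Fin (dimE ρ))))).toReal := by
  set B : Set (EuclideanSpace ℝ (Fin (dimE ρ))) := closedBall 0 r with hBdef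
  have hB4 : B ⊆ closedBall (0 : EuclideanSpace ℝ (Fin (dimE ρ))) (1 / 4) := closedBall_subset_closedBall hr
  have hSm : Measurable fun U : LGConfig 4 G => Real.exp (-β * wilsonBoundaryAction ρ (boxEdges 4 (2 * H + 1)) U) :=
    (Real.continuous_exp.comp (continuous_const.mul (continuous_wilsonBoundaryAction _ hρc _))).measurable
  have hUm : Measurable fun v : ColdFreeCfg (G := G) H => coldExt (coldExt₁ v) := measurable_coldExt.comp measurable_coldExt₁
  set f : LGConfig 4 G → ℝ := fun U => (coldGoodSetG ρ H β ε).indicator Ψ U *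
    Real.exp (-β * wilsonBoundaryAction ρ (boxEdges 4 (2 * H + 1)) U) with hf
  have hfm : Measurable f := (hΨm.indicator (measurableSet_coldGoodSetG ρ hρc β ε)).mul hSm
  have hf0 : ∀ U, 0 ≤ f U := fun U => mul_nonneg (Set.indicator_nonneg (fun _ _ => hΨ0 _) _) (Real.exp_pos _).le
  -- Bochner → Lebesgue
  rw [show (∫ v, (coldGoodSetG ρ H β ε).indicator Ψ (coldExt (coldExt₁ v)) *
      Real.exp (-β * wilsonBoundaryAction ρ (boxEdges 4 (2 * H + 1)) (coldExt (coldExt₁ v)))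
      ∂(Measure.pi fun _ : ColdFreeIdx H => haarProbability G)) =
      ∫ v, f (coldExt (coldExt₁ v)) ∂(Measure.pi fun _ : ColdFreeIdx H => haarProbability G) from rfl,
    integral_eq_lintegral_of_nonneg_ae (ae_of_all _ fun v => hf0 _) ((hfm.comp hUm).aestronglyMeasurable)]
  congr 1
  -- the integrand vanishes unless every free link is in `ψ(B)`
  have hsupp : (Function.support fun v : ColdFreeCfg (G := G) H => ENNReal.ofReal (f (coldExt (coldExt₁ v)))) ⊆
      Set.pi Set.univ (fun _ => expChart ρ '' B) := by
    intro v hv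
    rw [Function.mem_support] at hv
    have hmem : coldExt (coldExt₁ v) ∈ coldGoodSetG ρ H β ε := by
      by_contra hnot
      exact hv (by simp [hf, Set.indicator_of_notMem hnot])
    exact fun e _ => mem_image_expChart_of_mem_coldGoodSetG ρ hρu hβ hH hball v hmem e
  rw [← setLIntegral_eq_of_support_subset hsupp,
    lintegral_pi_image_expChart ρ hρc hinj hB4 (F := fun v : ColdFreeCfg (G := G) H => ENNReal.ofReal (f (coldExt (coldExt₁ v))))
      (by exact (ENNReal.measurable_ofReal.comp hfm).comp hUm)]
  -- the chart configuration
  have hcfg : ∀ a : ColdFreeIdx H → EuclideanSpace ℝ (Fin (dimE ρ)),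
      coldExt (coldExt₁ fun i => expChart ρ (a i)) = chartCfgE ρ a := fun a => coldExt_coldExt₁_expChart ρ hρc hinj a
  simp_rw [hcfg]
  -- the density: `(ν|_B)^{⊗n} = (vol|_B)^{⊗n}` with density `Π_e c·g(w_e)`
  lift c to NNReal using hctop
  have hdens' : (chartMeasureE ρ (1 / 4)).restrict B =
      ((volume : Measure (EuclideanSpace ℝ (Fin (dimE ρ)))).restrict B).withDensity (fun a => (c : ℝ≥0∞) * ENNReal.ofReal (g a)) := by
    rw [hdens, withDensity_smul_measure, ← withDensity_smul' _ _ ENNReal.coe_ne_top]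
    rfl
  have hgm' : Measurable fun a : EuclideanSpace ℝ (Fin (dimE ρ)) => (c : ℝ≥0∞) * ENNReal.ofReal (g a) :=
    measurable_const.mul (ENNReal.measurable_ofReal.comp hgm)
  haveI : IsFiniteMeasure ((chartMeasureE ρ (1 / 4)).restrict B) := by
    haveI := isFiniteMeasure_chartMeasureE ρ hρc hinj; infer_instance
  haveI : SigmaFinite (((volume : Measure (EuclideanSpace ℝ (Fin (dimE ρ)))).restrict B).withDensity
      (fun a => (c : ℝ≥0∞) * ENNReal.ofReal (g a))) := by
    rw [← hdens']; infer_instance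
  have hm' : Measurable fun x : ColdFreeIdx H → EuclideanSpace ℝ (Fin (dimE ρ)) => ∏ i, (c : ℝ≥0∞) * ENNReal.ofReal (g (x i)) :=
    Finset.measurable_prod _ fun i _ => hgm'.fun_comp (measurable_pi_apply i)
  have hF' : Measurable fun a : ColdFreeIdx H → EuclideanSpace ℝ (Fin (dimE ρ)) => ENNReal.ofReal (f (chartCfgE ρ a)) :=
    (hfm.fun_comp (measurable_chartCfgE ρ hρc hinj)).ennreal_ofReal
  rw [hdens', pi_withDensity _ _ (fun _ => hgm'), ← Measure.restrict_pi_pi, volume_pi,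
    lintegral_withDensity_eq_lintegral_mul _ hm' hF']
  have hprod : ∀ w : ColdFreeIdx H → EuclideanSpace ℝ (Fin (dimE ρ)),
      ∏ e, (c : ℝ≥0∞) * ENNReal.ofReal (g (w e)) = (c : ℝ≥0∞) ^ Fintype.card (ColdFreeIdx H) * ∏ e, ENNReal.ofReal (g (w e)) := by
    intro w
    rw [Finset.prod_mul_distrib, Finset.prod_const, Finset.card_univ]
  have hmeas : Measurable fun w : ColdFreeIdx H → EuclideanSpace ℝ (Fin (dimE ρ)) =>
      ENNReal.ofReal (f (chartCfgE ρ w)) * ∏ e, ENNReal.ofReal (g (w e)) :=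
    ((ENNReal.measurable_ofReal.comp hfm).comp (measurable_chartCfgE ρ hρc hinj)).mul
      (Finset.measurable_prod _ fun e _ => (hgm.fun_comp (measurable_pi_apply e)).ennreal_ofReal)
  rw [← lintegral_const_mul _ hmeas]
  refine lintegral_congr fun w => ?_
  simp only [Pi.mul_apply, hprod, hf]
  ring

/-- **Step 3.**  For measurable `Ψ ≥ 0` and a density `g > 0`: the chart integral of Step 2 equals
`a · Z^D · ∫⁻ 𝟙_S(t) Ψ(cfgTE t) e^{tiltWE t} d(gaussD H D)`, `S = goodTE ∩ windowTE r`, with the constant `a` of the change of variables. -/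
theorem lintegral_chart_eq_const_mul_lintegral_gaussD (hρc : Continuous ρ) (hinj : Function.Injective ρ) {β ε r : ℝ}
    {g : EuclideanSpace ℝ (Fin (dimE ρ)) → ℝ} (hgm : Measurable g) (hgpos : ∀ a, 0 < g a)
    {Ψ : LGConfig 4 G → ℝ} (hΨm : Measurable Ψ) (hΨ0 : ∀ U, 0 ≤ Ψ U)
    {a : ℝ≥0∞} (ha : ∀ F : (ColdFreeIdx H → EuclideanSpace ℝ (Fin (dimE ρ))) → ℝ≥0∞, Measurable F →
      ∫⁻ w, F w ∂(volume : Measure (ColdFreeIdx H → EuclideanSpace ℝ (Fin (dimE ρ)))) =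
        a * ∫⁻ t, F (unscaleTE H (dimE ρ) β t) ∂(volume : Measure (TSpaceD H (dimE ρ)))) :
    ∫⁻ w in Set.pi Set.univ (fun _ => closedBall (0 : EuclideanSpace ℝ (Fin (dimE ρ))) r),
          ENNReal.ofReal ((coldGoodSetG ρ H β ε).indicator Ψ (chartCfgE ρ w) *
            Real.exp (-β * wilsonBoundaryAction ρ (boxEdges 4 (2 * H + 1)) (chartCfgE ρ w))) *
          ∏ e, ENNReal.ofReal (g (w e)) ∂(volume : Measure (ColdFreeIdx H → EuclideanSpace ℝ (Fin (dimE ρ)))) =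
      a * gaussZ (Qmat (fun e => e ∉ dirFreeEdges H) dirCorner (2 * H + 3)) ^ dimE ρ *
        ∫⁻ t, ENNReal.ofReal ((goodTE ρ H β ε ∩ {t | ∀ e, ‖unscaleTE H (dimE ρ) β t e‖ ≤ r}).indicator
          (fun t => Ψ (cfgTE ρ H β t) * Real.exp (tiltWE ρ H g β t)) t) ∂(gaussD H (dimE ρ)) := by
  set B : Set (EuclideanSpace ℝ (Fin (dimE ρ))) := closedBall 0 r with hBdef
  set S := goodTE ρ H β ε ∩ {t | ∀ e, ‖unscaleTE H (dimE ρ) β t e‖ ≤ r} with hS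
  have hBm : MeasurableSet (Set.pi Set.univ (fun _ : ColdFreeIdx H => B)) :=
    MeasurableSet.univ_pi fun _ => isClosed_closedBall.measurableSet
  have hSm : Measurable fun U : LGConfig 4 G => Real.exp (-β * wilsonBoundaryAction ρ (boxEdges 4 (2 * H + 1)) U) :=
    (Real.continuous_exp.comp (continuous_const.mul (continuous_wilsonBoundaryAction _ hρc _))).measurable
  have hind : Measurable fun U : LGConfig 4 G => (coldGoodSetG ρ H β ε).indicator Ψ U :=
    hΨm.indicator (measurableSet_coldGoodSetG ρ hρc β ε)
  have hdm : Measurable fun w : ColdFreeIdx H → EuclideanSpace ℝ (Fin (dimE ρ)) => ∏ e, ENNReal.ofReal (g (w e)) :=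
    Finset.measurable_prod _ fun e _ => (hgm.fun_comp (measurable_pi_apply e)).ennreal_ofReal
  set F : (ColdFreeIdx H → EuclideanSpace ℝ (Fin (dimE ρ))) → ℝ≥0∞ := fun w =>
    ENNReal.ofReal ((coldGoodSetG ρ H β ε).indicator Ψ (chartCfgE ρ w) *
      Real.exp (-β * wilsonBoundaryAction ρ (boxEdges 4 (2 * H + 1)) (chartCfgE ρ w))) * ∏ e, ENNReal.ofReal (g (w e)) with hF
  have hFm : Measurable F :=
    (ENNReal.measurable_ofReal.comp ((hind.comp (measurable_chartCfgE ρ hρc hinj)).mul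
      (hSm.comp (measurable_chartCfgE ρ hρc hinj)))).mul hdm
  rw [← lintegral_indicator hBm, ha _ (hFm.indicator hBm)]
  -- pointwise identity in `t`
  have hpt : ∀ t : TSpaceD H (dimE ρ), (Set.pi Set.univ (fun _ : ColdFreeIdx H => B)).indicator F (unscaleTE H (dimE ρ) β t) =
      ENNReal.ofReal (S.indicator (fun t => Ψ (cfgTE ρ H β t) * Real.exp (tiltWE ρ H g β t)) t) *
        ∏ i, gaussWeight (Qmat (fun e => e ∉ dirFreeEdges H) dirCorner (2 * H + 3)) (t i) := by
    intro t
    by_cases hw : unscaleTE H (dimE ρ) β t ∈ Set.pi Set.univ (fun _ : ColdFreeIdx H => B)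
    · rw [Set.indicator_of_mem hw]
      have hw' : ∀ e, ‖unscaleTE H (dimE ρ) β t e‖ ≤ r := fun e => mem_closedBall_zero_iff.1 (hw e (Set.mem_univ _))
      have hcfg : chartCfgE ρ (unscaleTE H (dimE ρ) β t) = cfgTE ρ H β t := rfl
      rw [hF]; dsimp only
      rw [hcfg, ENNReal.ofReal_mul (Set.indicator_nonneg (fun _ _ => hΨ0 _) _), mul_assoc,
        boltzmann_mul_density_eq ρ g β t (fun e => hgpos _)]
      by_cases ht : t ∈ goodTE ρ H β ε
      · have hU : cfgTE ρ H β t ∈ coldGoodSetG ρ H β ε := ht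
        have htS : t ∈ S := ⟨ht, hw'⟩
        rw [Set.indicator_of_mem hU, Set.indicator_of_mem htS, ENNReal.ofReal_mul (hΨ0 _)]
        ring
      · have hU : cfgTE ρ H β t ∉ coldGoodSetG ρ H β ε := ht
        have htS : t ∉ S := fun h => ht h.1
        rw [Set.indicator_of_notMem hU, Set.indicator_of_notMem htS]
        simp
    · rw [Set.indicator_of_notMem hw]
      have htS : t ∉ S := fun h => hw (fun e _ => mem_closedBall_zero_iff.2 (h.2 e))
      rw [Set.indicator_of_notMem htS]
      simp
  simp_rw [hpt]
  have hSmeas : MeasurableSet S := by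
    refine (measurableSet_goodTE ρ hρc hinj β ε).inter ?_
    have : {t : TSpaceD H (dimE ρ) | ∀ e, ‖unscaleTE H (dimE ρ) β t e‖ ≤ r} = ⋂ e, (fun t => unscaleTE H (dimE ρ) β t e) ⁻¹' B := by
      ext t; simp [hBdef]
    rw [this]
    exact MeasurableSet.iInter fun e =>
      ((measurable_pi_apply e).comp (measurable_unscaleTE (dimE ρ) β)) isClosed_closedBall.measurableSet
  have hg2 : Measurable fun t : TSpaceD H (dimE ρ) =>
      ENNReal.ofReal (S.indicator (fun t => Ψ (cfgTE ρ H β t) * Real.exp (tiltWE ρ H g β t)) t) :=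
    ENNReal.measurable_ofReal.comp ((((hΨm.comp (measurable_cfgTE ρ hρc hinj β)).mul
      (Real.measurable_exp.comp (measurable_tiltWE ρ hρc hinj hgm β))).indicator hSmeas))
  rw [lintegral_mul_prod_gaussWeight_eq_D (dimE ρ) _ hg2, mul_assoc]

/-! ## §4 The representation theorem -/

/-- **THE REPRESENTATION (every compact group presented in `U(N)`).**  Let `ρ : G →* U(N)` be faithful, continuous and unitary, `β > 0`,
`H ≥ 1`; let `B = closedBall 0 r`, `r ≤ 1/4`, be a chart ball containing (through `ψ = expChart ρ`) every group element within the link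
window `‖ρ g − 1‖_F ≤ (12H²+2H+1)·√2·√(β^{2ε−1})` (`hball`: von Neumann local surjectivity at the scale of brick B3); let the Haar
measure in the chart have the density `c·g` on `B`, `g > 0` measurable (`hdens`, brick B5); and let the good events be charged.  Then for
every measurable gauge-invariant `X ≥ 0`, the expectation of `X` under the cold-wall box state CONDITIONED on the small-field event
`coldGoodSetG ρ H β ε` equals the expectation of `X ∘ cfgTE` under the TILT by `𝟙_S·tiltWE ρ H g β` of the `D`-colour Dirichlet Gaussian
`gaussD H D` CONDITIONED on `S = goodTE ρ H β ε ∩ {t | ∀ e, ‖unscaleTE t e‖ ≤ r}` (the lead's convention, INTEGRATE-2245).  All constants (`c^n`, the Jacobian, `Z^D`) cancel. -/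
theorem integral_cond_boxState_eq_integral_tilted_G (hρc : Continuous ρ) (hinj : Function.Injective ρ)
    (hρu : ∀ g, ρ g ∈ Matrix.unitaryGroup (Fin N) ℂ) {β ε r : ℝ} (hβ : 0 < β) (hH : 1 ≤ H) (hr : r ≤ 1 / 4)
    (hball : ∀ u : G, ‖ρ u - 1‖ ≤ (12 * (H : ℝ) ^ 2 + 2 * H + 1) * (Real.sqrt 2 * Real.sqrt (β ^ (2 * ε - 1))) →
      u ∈ expChart ρ '' closedBall (0 : EuclideanSpace ℝ (Fin (dimE ρ))) r)
    {g : EuclideanSpace ℝ (Fin (dimE ρ)) → ℝ} (hgm : Measurable g) (hgpos : ∀ a, 0 < g a) {c : ℝ≥0∞} (hc0 : c ≠ 0) (hctop : c ≠ ∞)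
    (hdens : (chartMeasureE ρ (1 / 4)).restrict (closedBall 0 r) =
      (c • (volume : Measure (EuclideanSpace ℝ (Fin (dimE ρ)))).restrict (closedBall 0 r)).withDensity
        (fun a => ENNReal.ofReal (g a)))
    (hG0 : boxState ρ β H (coldGoodSetG ρ H β ε) ≠ 0)
    (hγ : gaussD H (dimE ρ) (goodTE ρ H β ε ∩ {t | ∀ e, ‖unscaleTE H (dimE ρ) β t e‖ ≤ r}) ≠ 0)
    {X : LGConfig 4 G → ℝ} (hXm : Measurable X) (hXinv : IsZdGaugeInvariant X) (hX0 : ∀ U, 0 ≤ X U) :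
    ∫ U, X U ∂((boxState ρ β H)[|coldGoodSetG ρ H β ε]) =
      ∫ t, X (cfgTE ρ H β t) ∂(((gaussD H (dimE ρ))[|goodTE ρ H β ε ∩ {t | ∀ e, ‖unscaleTE H (dimE ρ) β t e‖ ≤ r}]).tilted
        ((goodTE ρ H β ε ∩ {t | ∀ e, ‖unscaleTE H (dimE ρ) β t e‖ ≤ r}).indicator (tiltWE ρ H g β))) := by
  have hSmeas : MeasurableSet (goodTE ρ H β ε ∩ {t | ∀ e, ‖unscaleTE H (dimE ρ) β t e‖ ≤ r}) := by
    refine (measurableSet_goodTE ρ hρc hinj β ε).inter ?_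
    have : {t : TSpaceD H (dimE ρ) | ∀ e, ‖unscaleTE H (dimE ρ) β t e‖ ≤ r} =
        ⋂ e, (fun t => unscaleTE H (dimE ρ) β t e) ⁻¹' closedBall (0 : EuclideanSpace ℝ (Fin (dimE ρ))) r := by
      ext t; simp
    rw [this]
    exact MeasurableSet.iInter fun e =>
      ((measurable_pi_apply e).comp (measurable_unscaleTE (dimE ρ) β)) isClosed_closedBall.measurableSet
  haveI : IsProbabilityMeasure (gaussD H (dimE ρ)) := isProbabilityMeasure_gaussD H (dimE ρ)
  obtain ⟨a, ha0, hatop, ha⟩ := exists_lintegral_eq_mul_lintegral_unscaleTE (H := H) (dimE ρ) hβ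
  rw [integral_tilted_cond_eq_ratio (gaussD H (dimE ρ)) hSmeas hγ (measurable_tiltWE ρ hρc hinj hgm β)
      (φ := fun t => X (cfgTE ρ H β t)) (hXm.comp (measurable_cfgTE ρ hρc hinj β)) (fun t => hX0 _),
    integral_cond_boxState_eq_ratio_G ρ hρc β ε H hG0 hXm hXinv,
    freeIntegral_indicator_eq_lintegral_chart_G ρ hρc hinj hρu hβ hH hr hball hgm hctop hdens hXm hX0,
    freeIntegral_indicator_eq_lintegral_chart_G ρ hρc hinj hρu hβ hH hr hball hgm hctop hdens measurable_const
      (fun _ => zero_le_one),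
    lintegral_chart_eq_const_mul_lintegral_gaussD ρ hρc hinj hgm hgpos hXm hX0 ha,
    lintegral_chart_eq_const_mul_lintegral_gaussD ρ hρc hinj hgm hgpos measurable_const (fun _ => zero_le_one) ha]
  simp only [one_mul]
  obtain ⟨-, hZ0, hZtop⟩ := boxDirichlet_eq_withDensity H
  set K : ℝ := (c ^ Fintype.card (ColdFreeIdx H)).toReal * (a.toReal *
      ((gaussZ (Qmat (fun e => e ∉ dirFreeEdges H) dirCorner (2 * H + 3))) ^ dimE ρ).toReal) with hK
  have hK0 : K ≠ 0 := by
    refine mul_ne_zero ?_ (mul_ne_zero (ENNReal.toReal_ne_zero.2 ⟨ha0, hatop⟩) ?_)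
    · exact ENNReal.toReal_ne_zero.2 ⟨pow_ne_zero _ hc0, ENNReal.pow_ne_top hctop⟩
    · exact ENNReal.toReal_ne_zero.2 ⟨pow_ne_zero _ hZ0, ENNReal.pow_ne_top hZtop⟩
  have e1 : ∀ I : ℝ≥0∞, (c ^ Fintype.card (ColdFreeIdx H) *
      (a * gaussZ (Qmat (fun e => e ∉ dirFreeEdges H) dirCorner (2 * H + 3)) ^ dimE ρ * I)).toReal = K * I.toReal := by
    intro I; simp only [ENNReal.toReal_mul, hK]; ring
  rw [e1, e1, mul_div_mul_left _ _ hK0]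

end Box

end Summit.QuantumFields.YangMills.Theorems.ColdBoxAllGroups

end
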